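import Summits.Ventures.PercRepro2.CaseOneLeafDelete
import Summits.Ventures.PercRepro2.CaseOneDWorldPin

/-!
# Merging two parallel edges: every case-1 quantity is unchanged
(blind cell PercRepro2, p1 g22; S5 §2.2: the «merging of parallel edges» reduction rule as a kernel
transfer, the companion of the leaf deletion of `CaseOneLeafDelete`)

Two parallel edges `e₀, e₁` (same ends) of weights `p e₀, p e₁` are, for every connection event, one
edge of weight `p e₀ + p e₁ − p e₀ p e₁ = 1 − (1 − p e₀)(1 − p e₁)`. The map
`mergeCfg e₀ e₁ : Config E → Config {e // e ≠ e₁}` keeps every edge other than `e₁` and declares `e₀`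
open iff `e₀` or `e₁` is open in `ω`; the weights `mergeW p e₀ e₁` on `E − e₁` are `p` with the merged
weight at `e₀`. Then
* the open graphs coincide (`openAdj_merge_iff`, `openGraph_merge`), so every connection does
  (`conn_merge_iff`, `connEvent_merge`: the connection event in `G` is the preimage of the one in
  `G − e₁`) — with NO condition on the vertices;
* the product law pushes forward (`expect_merge`, `prob_merge`): two pinnings (at `e₀`, then `e₁`)
  reduce the left side to the restricted law, one pinning at the merged edge the right side, and the
  weights match by `p e₀ + (1 − p e₀) p e₁ = p e₀ + p e₁ − p e₀ p e₁`.
Hence every case-1 quantity at EVERY vertex is the same in `G` and in the merged graph (`Dpd_merge`,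
`Dpdo_merge`, `Dqo_merge`, `probQ_merge`, `iiExpr_merge`, `iExpr_merge`, `iiExprT_merge`,
`iExprT_merge`), and the four Props transfer in both directions (`zSplitII_merge_iff`, `zSplitIIQ_merge_iff`,
`zSplitI_merge_iff`, `zSplitIQ_merge_iff`; the `_of_merge` directions). Consequence: every class theorem
of the rung extends to multigraph thickenings — parallel copies of any edge, anywhere, including at the
statement vertex — by merging the copies first. Own code; standard axioms. -/

namespace Summit.Ventures.PercRepro2

namespace CaseOne

/-! ## The merge map and the merged weights -/

section MergeDefs
variable {V : Type*} {E : Type*} [DecidableEq E] {R : Type*} [CommRing R]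

/-- The configuration of `G − e₁` in which `e₀` is open iff `e₀` or `e₁` is open in `ω`; every other
edge keeps its state. -/
def mergeCfg (e₀ e₁ : E) (ω : Config E) : Config {e : E // e ≠ e₁} :=
  fun e => if e.1 = e₀ then (ω e₀ || ω e₁) else ω e.1

/-- The weights of `G − e₁` with the merged weight `p e₀ + p e₁ − p e₀ p e₁` at `e₀`. -/
def mergeW (p : E → R) (e₀ e₁ : E) : {e : E // e ≠ e₁} → R :=
  fun e => if e.1 = e₀ then p e₀ + p e₁ - p e₀ * p e₁ else p e.1

variable {ends : E → Sym2 V} {e₀ e₁ : E}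

omit [CommRing R] in
/-- **Open adjacency is the same in `G` and in the merged graph** (for parallel `e₀, e₁`). -/
lemma openAdj_merge_iff (hpar : ends e₀ = ends e₁) (hne : e₀ ≠ e₁) (ω : Config E) {x y : V} :
    OpenAdj ends ω x y ↔ OpenAdj (restrictEnds ends e₁) (mergeCfg e₀ e₁ ω) x y := by
  constructor
  · rintro ⟨e, he, hends⟩
    by_cases h1 : e = e₁
    · rw [h1] at he hends
      refine ⟨⟨e₀, hne⟩, ?_, ?_⟩
      · simp [mergeCfg, he]
      · show ends e₀ = s(x, y)
        rw [hpar]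
        exact hends
    · refine ⟨⟨e, h1⟩, ?_, hends⟩
      by_cases h0 : e = e₀
      · rw [h0] at he
        simp [mergeCfg, h0, he]
      · simp [mergeCfg, h0, he]
  · rintro ⟨⟨e, h1⟩, he, hends⟩
    have hends' : ends e = s(x, y) := hends
    by_cases h0 : e = e₀
    · have he' : ω e₀ = true ∨ ω e₁ = true := by simpa [mergeCfg, h0] using he
      rcases he' with h | h
      · exact ⟨e₀, h, by rw [← h0]; exact hends'⟩
      · exact ⟨e₁, h, by rw [← hpar, ← h0]; exact hends'⟩
    · have he' : ω e = true := by simpa [mergeCfg, h0] using he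
      exact ⟨e, he', hends'⟩

omit [CommRing R] in
/-- The open graphs of `G` and of the merged graph coincide. -/
lemma openGraph_merge (hpar : ends e₀ = ends e₁) (hne : e₀ ≠ e₁) (ω : Config E) :
    openGraph ends ω = openGraph (restrictEnds ends e₁) (mergeCfg e₀ e₁ ω) := by
  ext x y
  rw [openGraph_adj, openGraph_adj, openAdj_merge_iff hpar hne ω]

omit [CommRing R] in
/-- **Connections are the same in `G` and in the merged graph**, for every pair of vertices. -/
lemma conn_merge_iff (hpar : ends e₀ = ends e₁) (hne : e₀ ≠ e₁) (ω : Config E) {x y : V} :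
    Conn ends ω x y ↔ Conn (restrictEnds ends e₁) (mergeCfg e₀ e₁ ω) x y := by
  unfold Conn
  rw [openGraph_merge hpar hne ω]

omit [CommRing R] in
/-- The connection event in `G` is the preimage of the connection event in the merged graph. -/
theorem connEvent_merge (hpar : ends e₀ = ends e₁) (hne : e₀ ≠ e₁) (x y : V) :
    connEvent ends x y = mergeCfg e₀ e₁ ⁻¹' connEvent (restrictEnds ends e₁) x y := by
  ext ω
  simp only [mem_connEvent, Set.mem_preimage]
  exact conn_merge_iff hpar hne ω

end MergeDefs

/-! ## The push-forward of the product law -/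

section MergeMeasure
variable {E : Type*} [Fintype E] [DecidableEq E] {R : Type*} [CommRing R]

omit [Fintype E] in
/-- The merge of a configuration pinned at `e₁` and then at `e₀` is the restriction updated at `e₀`
with the disjunction of the two pinned states. -/
lemma mergeCfg_update_update (e₀ e₁ : E) (hne : e₀ ≠ e₁) (ω : Config E) (c d : Bool) :
    mergeCfg e₀ e₁ (Function.update (Function.update ω e₁ d) e₀ c) =
      Function.update (restrictCfg e₁ ω) ⟨e₀, hne⟩ (c || d) := by
  funext e
  by_cases h : e = ⟨e₀, hne⟩
  · subst h
    simp [mergeCfg, Function.update_of_ne hne.symm]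
  · have h0 : e.1 ≠ e₀ := fun h' => h (Subtype.ext h')
    simp [mergeCfg, h0, Function.update_of_ne h, Function.update_of_ne e.2, restrictCfg]

omit [Fintype E] in
/-- Assembling the restriction of `ω` with a state `c` at `e` is the update of `ω` at `e`. -/
lemma cfgEquiv_symm_restrictCfg (e : E) (ω : Config E) (c : Bool) :
    (cfgEquiv e).symm (restrictCfg e ω, c) = Function.update ω e c := by
  funext f
  by_cases h : f = e
  · subst h
    simp [cfgEquiv]
  · simp [cfgEquiv, restrictCfg, h]

/-- The expectation of a function that ignores the edge `e` does not depend on the weight of `e`. -/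
lemma expect_congr_of_ignore (p q : E → R) (e : E) (hpq : ∀ f, f ≠ e → p f = q f)
    (F : Config E → R) (hF : ∀ ω c, F (Function.update ω e c) = F ω) : expect p F = expect q F := by
  have hFe : ∀ ω, F ω = F ((cfgEquiv e).symm (restrictCfg e ω, false)) := by
    intro ω
    rw [cfgEquiv_symm_restrictCfg, hF]
  have hpq' : restrictW p e = restrictW q e := by
    funext f
    exact hpq f.1 f.2
  have hp : expect p F = expect (restrictW p e) (fun ω' => F ((cfgEquiv e).symm (ω', false))) := by
    rw [← expect_restrict p e]
    exact congrArg (expect p) (funext hFe)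
  have hq : expect q F = expect (restrictW q e) (fun ω' => F ((cfgEquiv e).symm (ω', false))) := by
    rw [← expect_restrict q e]
    exact congrArg (expect q) (funext hFe)
  rw [hp, hq, hpq']

omit [Fintype E] in
/-- The merged weight at the merged edge. -/
lemma mergeW_self (p : E → R) (e₀ e₁ : E) (hne : e₀ ≠ e₁) :
    mergeW p e₀ e₁ ⟨e₀, hne⟩ = p e₀ + p e₁ - p e₀ * p e₁ := by
  simp [mergeW]

omit [Fintype E] in
/-- Off the merged edge the merged weights are the restricted weights. -/
lemma mergeW_of_ne (p : E → R) (e₀ e₁ : E) (hne : e₀ ≠ e₁) (f : {e : E // e ≠ e₁})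
    (hf : f ≠ ⟨e₀, hne⟩) : mergeW p e₀ e₁ f = restrictW p e₁ f := by
  have h0 : f.1 ≠ e₀ := fun h' => hf (Subtype.ext h')
  simp [mergeW, restrictW, h0]

/-- **Push-forward of the product law under the merge**: the expectation of a function of the merged
configuration is its expectation under the merged weights. -/
theorem expect_merge (p : E → R) (e₀ e₁ : E) (hne : e₀ ≠ e₁) (f : Config {e : E // e ≠ e₁} → R) :
    expect p (fun ω => f (mergeCfg e₀ e₁ ω)) = expect (mergeW p e₀ e₁) f := by
  -- the left side after pinning `e₀` (state `c`) and then `e₁`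
  have key : ∀ c : Bool, expect p (fun ω => f (mergeCfg e₀ e₁ (Function.update ω e₀ c))) =
      p e₁ * expect (restrictW p e₁) (fun ω' => f (Function.update ω' ⟨e₀, hne⟩ (c || true))) +
        (1 - p e₁) * expect (restrictW p e₁)
          (fun ω' => f (Function.update ω' ⟨e₀, hne⟩ (c || false))) := by
    intro c
    rw [expect_eq_update_pin p _ e₁]
    simp only [mergeCfg_update_update e₀ e₁ hne]
    rw [expect_restrict p e₁ (fun ω' => f (Function.update ω' ⟨e₀, hne⟩ (c || true))),
      expect_restrict p e₁ (fun ω' => f (Function.update ω' ⟨e₀, hne⟩ (c || false)))]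
  have hL : expect p (fun ω => f (mergeCfg e₀ e₁ ω)) =
      p e₀ * (p e₁ * expect (restrictW p e₁) (fun ω' => f (Function.update ω' ⟨e₀, hne⟩ true)) +
        (1 - p e₁) * expect (restrictW p e₁) (fun ω' => f (Function.update ω' ⟨e₀, hne⟩ true))) +
      (1 - p e₀) * (p e₁ * expect (restrictW p e₁) (fun ω' => f (Function.update ω' ⟨e₀, hne⟩ true)) +
        (1 - p e₁) * expect (restrictW p e₁) (fun ω' => f (Function.update ω' ⟨e₀, hne⟩ false))) := by
    rw [expect_eq_update_pin p _ e₀]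
    rw [key true, key false]
    simp only [Bool.true_or, Bool.false_or]
  -- the right side after pinning the merged edge
  have hR : expect (mergeW p e₀ e₁) f =
      (p e₀ + p e₁ - p e₀ * p e₁) *
          expect (restrictW p e₁) (fun ω' => f (Function.update ω' ⟨e₀, hne⟩ true)) +
        (1 - (p e₀ + p e₁ - p e₀ * p e₁)) *
          expect (restrictW p e₁) (fun ω' => f (Function.update ω' ⟨e₀, hne⟩ false)) := by
    rw [expect_eq_update_pin (mergeW p e₀ e₁) f ⟨e₀, hne⟩, mergeW_self p e₀ e₁ hne]
    have hT : expect (mergeW p e₀ e₁) (fun ω' => f (Function.update ω' ⟨e₀, hne⟩ true)) =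
        expect (restrictW p e₁) (fun ω' => f (Function.update ω' ⟨e₀, hne⟩ true)) :=
      expect_congr_of_ignore _ _ ⟨e₀, hne⟩ (mergeW_of_ne p e₀ e₁ hne) _
        (fun ω c => by simp only [Function.update_idem])
    have hF : expect (mergeW p e₀ e₁) (fun ω' => f (Function.update ω' ⟨e₀, hne⟩ false)) =
        expect (restrictW p e₁) (fun ω' => f (Function.update ω' ⟨e₀, hne⟩ false)) :=
      expect_congr_of_ignore _ _ ⟨e₀, hne⟩ (mergeW_of_ne p e₀ e₁ hne) _
        (fun ω c => by simp only [Function.update_idem])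
    rw [hT, hF]
  rw [hL, hR]
  ring

/-- Push-forward of the product law under the merge, for events. -/
theorem prob_merge (p : E → R) (e₀ e₁ : E) (hne : e₀ ≠ e₁) (A : Set (Config {e : E // e ≠ e₁})) :
    prob p (mergeCfg e₀ e₁ ⁻¹' A) = prob (mergeW p e₀ e₁) A := by
  rw [prob_eq_expect_indicator, prob_eq_expect_indicator, ← expect_merge p e₀ e₁ hne]
  rfl

omit [Fintype E] in
/-- The merged weights of a probability vector form a probability vector. -/
lemma IsProbVec.mergeW [LinearOrder R] [IsStrictOrderedRing R] {p : E → R} (hp : IsProbVec p)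
    (e₀ e₁ : E) : IsProbVec (mergeW p e₀ e₁) := by
  refine ⟨fun e => ?_, fun e => ?_⟩
  · by_cases h : e.1 = e₀
    · have he : CaseOne.mergeW p e₀ e₁ e = p e₀ + p e₁ - p e₀ * p e₁ := by
        simp [CaseOne.mergeW, h]
      rw [he]
      have h0 := hp.nonneg e₀
      have h1 := hp.nonneg e₁
      have h0' := hp.le_one e₀
      nlinarith [mul_nonneg h1 (sub_nonneg.2 h0')]
    · have he : CaseOne.mergeW p e₀ e₁ e = p e.1 := by
        simp [CaseOne.mergeW, h]
      rw [he]
      exact hp.nonneg e.1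
  · by_cases h : e.1 = e₀
    · have he : CaseOne.mergeW p e₀ e₁ e = p e₀ + p e₁ - p e₀ * p e₁ := by
        simp [CaseOne.mergeW, h]
      rw [he]
      have h0' := hp.le_one e₀
      have h1' := hp.le_one e₁
      nlinarith [mul_nonneg (sub_nonneg.2 h0') (sub_nonneg.2 h1')]
    · have he : CaseOne.mergeW p e₀ e₁ e = p e.1 := by
        simp [CaseOne.mergeW, h]
      rw [he]
      exact hp.le_one e.1

end MergeMeasure

/-! ## The case-1 quantities at every vertex -/

section Transfer
variable {V : Type*} {E : Type*} [Fintype E] [DecidableEq E] {R : Type*} [CommRing R]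
variable {ends : E → Sym2 V} {o a₁ a₂ v b : V} {e₀ e₁ : E}

/-- `D` is unchanged by merging two parallel edges. -/
theorem Dpd_merge (p : E → R) (hpar : ends e₀ = ends e₁) (hne : e₀ ≠ e₁) :
    Dpd p ends a₁ a₂ v = Dpd (mergeW p e₀ e₁) (restrictEnds ends e₁) a₁ a₂ v := by
  unfold Dpd
  simp only [connEvent_merge hpar hne, ← Set.preimage_compl, ← Set.preimage_inter,
    prob_merge p e₀ e₁ hne]

/-- `D_o` is unchanged by merging two parallel edges. -/
theorem Dpdo_merge (p : E → R) (hpar : ends e₀ = ends e₁) (hne : e₀ ≠ e₁) :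
    Dpdo p ends o a₁ a₂ v = Dpdo (mergeW p e₀ e₁) (restrictEnds ends e₁) o a₁ a₂ v := by
  unfold Dpdo
  simp only [connEvent_merge hpar hne, ← Set.preimage_compl, ← Set.preimage_inter,
    ← Set.preimage_union, prob_merge p e₀ e₁ hne]

/-- `P(Q, o ∈ U)` is unchanged by merging two parallel edges. -/
theorem Dqo_merge (p : E → R) (hpar : ends e₀ = ends e₁) (hne : e₀ ≠ e₁) :
    Dqo p ends o a₁ a₂ = Dqo (mergeW p e₀ e₁) (restrictEnds ends e₁) o a₁ a₂ := by
  unfold Dqo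
  simp only [connEvent_merge hpar hne, ← Set.preimage_compl, ← Set.preimage_inter,
    ← Set.preimage_union, prob_merge p e₀ e₁ hne]

/-- `P(Q)` is unchanged by merging two parallel edges. -/
theorem probQ_merge (p : E → R) (hpar : ends e₀ = ends e₁) (hne : e₀ ≠ e₁) :
    prob p (connEvent ends a₁ a₂)ᶜ =
      prob (mergeW p e₀ e₁) (connEvent (restrictEnds ends e₁) a₁ a₂)ᶜ := by
  rw [connEvent_merge hpar hne, ← Set.preimage_compl, prob_merge p e₀ e₁ hne]

/-- **`iiExpr` is unchanged by merging two parallel edges.** -/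
theorem iiExpr_merge (p : E → R) (hpar : ends e₀ = ends e₁) (hne : e₀ ≠ e₁) :
    iiExpr p ends o a₁ a₂ v b = iiExpr (mergeW p e₀ e₁) (restrictEnds ends e₁) o a₁ a₂ v b := by
  rw [iiExpr_eq_probs, iiExpr_eq_probs, Dpd_merge p hpar hne, Dpdo_merge p hpar hne]
  simp only [connEvent_merge hpar hne, ← Set.preimage_compl, ← Set.preimage_inter,
    prob_merge p e₀ e₁ hne]

/-- **`iExpr` is unchanged by merging two parallel edges.** -/
theorem iExpr_merge (p : E → R) (hpar : ends e₀ = ends e₁) (hne : e₀ ≠ e₁) :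
    iExpr p ends o a₁ a₂ v b = iExpr (mergeW p e₀ e₁) (restrictEnds ends e₁) o a₁ a₂ v b := by
  rw [iExpr_eq_iExprT, iExpr_eq_iExprT, iExprT_eq, iExprT_eq, Dpd_merge p hpar hne,
    Dpdo_merge p hpar hne]
  simp only [connEvent_merge hpar hne, ← Set.preimage_compl, ← Set.preimage_inter,
    prob_merge p e₀ e₁ hne]

/-- **`iiExprT` is unchanged by merging two parallel edges** (any threshold pair). -/
theorem iiExprT_merge (p : E → R) (hpar : ends e₀ = ends e₁) (hne : e₀ ≠ e₁) (c₀ c₁ : R) :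
    iiExprT p ends o a₁ a₂ v b c₀ c₁ =
      iiExprT (mergeW p e₀ e₁) (restrictEnds ends e₁) o a₁ a₂ v b c₀ c₁ := by
  rw [iiExprT_eq, iiExprT_eq]
  simp only [connEvent_merge hpar hne, ← Set.preimage_compl, ← Set.preimage_inter,
    prob_merge p e₀ e₁ hne]

/-- **`iExprT` is unchanged by merging two parallel edges** (any threshold pair). -/
theorem iExprT_merge (p : E → R) (hpar : ends e₀ = ends e₁) (hne : e₀ ≠ e₁) (c₀ c₁ : R) :
    iExprT p ends o a₁ a₂ v b c₀ c₁ =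
      iExprT (mergeW p e₀ e₁) (restrictEnds ends e₁) o a₁ a₂ v b c₀ c₁ := by
  rw [iExprT_eq, iExprT_eq]
  simp only [connEvent_merge hpar hne, ← Set.preimage_compl, ← Set.preimage_inter,
    prob_merge p e₀ e₁ hne]

end Transfer

/-! ## The Props transfer (both directions) -/

section Props
variable {V : Type*} {E : Type*} [Fintype E] [DecidableEq E] {R : Type*} [CommRing R] [LinearOrder R]
variable {ends : E → Sym2 V} {o a₁ a₂ v b : V} {e₀ e₁ : E}

/-- `(ii)` in `G` iff `(ii)` in the merged graph. -/
theorem zSplitII_merge_iff (p : E → R) (hpar : ends e₀ = ends e₁) (hne : e₀ ≠ e₁) :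
    ZSplitII p ends o a₁ a₂ v b ↔ ZSplitII (mergeW p e₀ e₁) (restrictEnds ends e₁) o a₁ a₂ v b := by
  unfold ZSplitII
  rw [iiExpr_merge p hpar hne]

/-- `(i)` in `G` iff `(i)` in the merged graph. -/
theorem zSplitI_merge_iff (p : E → R) (hpar : ends e₀ = ends e₁) (hne : e₀ ≠ e₁) :
    ZSplitI p ends o a₁ a₂ v b ↔ ZSplitI (mergeW p e₀ e₁) (restrictEnds ends e₁) o a₁ a₂ v b := by
  unfold ZSplitI
  rw [iExpr_merge p hpar hne]

/-- `(ii-Q)` in `G` iff `(ii-Q)` in the merged graph. -/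
theorem zSplitIIQ_merge_iff (p : E → R) (hpar : ends e₀ = ends e₁) (hne : e₀ ≠ e₁) :
    ZSplitIIQ p ends o a₁ a₂ v b ↔
      ZSplitIIQ (mergeW p e₀ e₁) (restrictEnds ends e₁) o a₁ a₂ v b := by
  unfold ZSplitIIQ
  rw [iiExprT_merge p hpar hne, Dqo_merge p hpar hne, probQ_merge p hpar hne]

/-- `(i-Q)` in `G` iff `(i-Q)` in the merged graph. -/
theorem zSplitIQ_merge_iff (p : E → R) (hpar : ends e₀ = ends e₁) (hne : e₀ ≠ e₁) :
    ZSplitIQ p ends o a₁ a₂ v b ↔ ZSplitIQ (mergeW p e₀ e₁) (restrictEnds ends e₁) o a₁ a₂ v b := by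
  unfold ZSplitIQ
  rw [iExprT_merge p hpar hne, Dqo_merge p hpar hne, probQ_merge p hpar hne]

/-- `(ii)` in the merged graph gives `(ii)` in `G`. -/
theorem zSplitII_of_merge (p : E → R) (hpar : ends e₀ = ends e₁) (hne : e₀ ≠ e₁)
    (h : ZSplitII (mergeW p e₀ e₁) (restrictEnds ends e₁) o a₁ a₂ v b) : ZSplitII p ends o a₁ a₂ v b :=
  (zSplitII_merge_iff p hpar hne).2 h

/-- `(i)` in the merged graph gives `(i)` in `G`. -/
theorem zSplitI_of_merge (p : E → R) (hpar : ends e₀ = ends e₁) (hne : e₀ ≠ e₁)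
    (h : ZSplitI (mergeW p e₀ e₁) (restrictEnds ends e₁) o a₁ a₂ v b) : ZSplitI p ends o a₁ a₂ v b :=
  (zSplitI_merge_iff p hpar hne).2 h

/-- `(ii-Q)` in the merged graph gives `(ii-Q)` in `G`. -/
theorem zSplitIIQ_of_merge (p : E → R) (hpar : ends e₀ = ends e₁) (hne : e₀ ≠ e₁)
    (h : ZSplitIIQ (mergeW p e₀ e₁) (restrictEnds ends e₁) o a₁ a₂ v b) :
    ZSplitIIQ p ends o a₁ a₂ v b :=
  (zSplitIIQ_merge_iff p hpar hne).2 h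

/-- `(i-Q)` in the merged graph gives `(i-Q)` in `G`. -/
theorem zSplitIQ_of_merge (p : E → R) (hpar : ends e₀ = ends e₁) (hne : e₀ ≠ e₁)
    (h : ZSplitIQ (mergeW p e₀ e₁) (restrictEnds ends e₁) o a₁ a₂ v b) : ZSplitIQ p ends o a₁ a₂ v b :=
  (zSplitIQ_merge_iff p hpar hne).2 h

end Props

end CaseOne

end Summit.Ventures.PercRepro2
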